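import Literature.Barriers.BirchSwinnertonDyer.PlecticDeterminantOverQ
import HarnessLib

/-!
# Crux `PlecticRankUB` (stmt-BirchSwinnertonDyer-17519), line `Sketch` — stub S4
# `stub_receptacleCollapse`: two columns through one line kill the localised determinant

Registered stub S4 of the skeleton of line `Sketch` (route `PlecticLegs`, crux #3,
`Summit.BirchSwinnertonDyer.BirchSwinnertonDyer.Theses.PlecticLegs.PlecticRankUB`): a DESIGN
lemma of pure linear algebra (a no-go result; it does not feed the composition of the line).

For a field `K`, a `K`-space `V` of "global points", receptacles `L j` (`j : Fin r`) and
localisation maps `ι j : V →ₗ[K] L j`, the localised determinant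
`locDeterminant ι : V [⋀^Fin r]→ₗ[K] ⨂_j L j`, `(P_k)_k ↦ Σ_σ sgn σ · ⊗_k ι_k(P_{σ k})`
(`Literature.Barriers.BirchSwinnertonDyer.locDeterminant`, the Leibniz expansion of
Fornea–Gehrmann's `det (ι_{𝔭_j}(P_i))_{i,j}`, Adv. Math. 414 (2023), §1.1) vanishes IDENTICALLY as
soon as TWO of the columns, `ι i` and `ι j` with `i ≠ j`, factor through a common space `L₀` of
rank `≤ 1`: `ι i = eᵢ ∘ κ`, `ι j = e_j ∘ κ` for one `κ : V →ₗ[K] L₀`. This generalises the tree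
theorem `plecticDeterminant_restrict_eq_zero` (ALL columns through the line; Fornea–Gehrmann,
Rem. 1.1: "equals zero because `Â(ℚ_p)` has `ℤ_p`-rank one") to the shape of Fornea's receptacle
with `r - 1 ≥ 2` local columns read on `ℚ`-points (`receptacleCollapse_of_stub` in the skeleton).

## Proof

Write `κ (x i) = a • v₀`, `κ (x j) = b • v₀` (`rank_le_one_iff`). The multilinear map
`m x = ⊗_k ι_k(x_k)` is symmetric under the transposition of the slots `i`, `j`
(`tprod_ι_comp_swap`): both `m x` and `m (x ∘ (i j))` are obtained from the family
`y_k = ι_k(x_k)` by putting `a • eᵢ v₀`, `b • e_j v₀` (resp. `b • eᵢ v₀`, `a • e_j v₀`) in the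
slots `i`, `j`, and a multilinear map takes the same value `a b • (…)` on both
(`map_update_update_smul_comm`). Finally the alternatization `Σ_σ sgn σ · m (v ∘ σ)` of a
multilinear map symmetric under a transposition vanishes (`alternatization_eq_zero_of_comp_swap`):
the terms `σ` and `σ ∘ (i j)` cancel in pairs (`Finset.sum_involution`, exactly as in Mathlib's
`MultilinearMap.alternatization`); no assumption on the characteristic of `K` is needed.

## References

* M. Fornea, L. Gehrmann, *Plectic Stark–Heegner points*, Adv. Math. 414 (2023) 108861,
  arXiv:2104.12575, §1.1 and Rem. 1.1 [ForneaGehrmann2023].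
-/

-- `Summit.BirchSwinnertonDyer.BirchSwinnertonDyer` is the mandated summit-side namespace
-- (CONVENTIONS §2); the duplicate component is deliberate.
set_option linter.dupNamespace false

noncomputable section

open scoped TensorProduct
open PiTensorProduct Literature.Barriers.BirchSwinnertonDyer

namespace Summit.BirchSwinnertonDyer.BirchSwinnertonDyer.Theorems

/-- **Alternatization kills a multilinear map that is symmetric under a transposition.** If
`m (x ∘ (i j)) = m x` for all `x : ι' → M` (`i ≠ j`), then
`MultilinearMap.alternatization m = 0`, i.e. `Σ_σ sgn σ · m (v ∘ σ) = 0` for every `v`: the terms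
indexed by `σ` and `σ ∘ (i j)` have opposite signs and equal values, so the Leibniz sum cancels in
pairs (`Finset.sum_involution`). [folklore] -/
private theorem alternatization_eq_zero_of_comp_swap {R M N ι' : Type*} [CommSemiring R]
    [AddCommMonoid M] [Module R M] [AddCommGroup N] [Module R N] [Fintype ι'] [DecidableEq ι']
    (m : MultilinearMap R (fun _ : ι' => M) N) {i j : ι'} (hij : i ≠ j)
    (hm : ∀ x : ι' → M, m (x ∘ Equiv.swap i j) = m x) :
    MultilinearMap.alternatization m = 0 := by
  ext v
  rw [MultilinearMap.alternatization_apply, AlternatingMap.zero_apply]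
  refine Finset.sum_involution (fun σ _ => σ * Equiv.swap i j) (fun σ _ => ?_)
    (fun σ _ _ => (not_congr Equiv.mul_swap_eq_iff).mpr hij) (fun σ _ => Finset.mem_univ _)
    (fun σ _ => Equiv.mul_swap_mul_self i j σ)
  have h : m.domDomCongr (σ * Equiv.swap i j) v = m.domDomCongr σ v := hm fun k => v (σ k)
  simp only [h, Equiv.Perm.sign_mul, Equiv.Perm.sign_swap hij, mul_neg_one, Units.neg_smul,
    add_neg_cancel]

/-- **Scalars in two slots of a multilinear map commute.** For a multilinear map `f`, a family
`y`, indices `i ≠ j` and vectors `u`, `w` in the slots `i`, `j`: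
`f (y; i ↦ a • u, j ↦ b • w) = f (y; i ↦ b • u, j ↦ a • w)` — both equal `a b • f (y; i ↦ u, j ↦ w)`.
[folklore] -/
private theorem map_update_update_smul_comm {R ι' N : Type*} {M : ι' → Type*} [CommSemiring R]
    [∀ k, AddCommMonoid (M k)] [∀ k, Module R (M k)] [AddCommMonoid N] [Module R N]
    [DecidableEq ι'] (f : MultilinearMap R M N) (y : ∀ k, M k) {i j : ι'} (hij : i ≠ j)
    (a b : R) (u : M i) (w : M j) :
    f (Function.update (Function.update y i (a • u)) j (b • w)) =
      f (Function.update (Function.update y i (b • u)) j (a • w)) := by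
  have key : ∀ c d : R, f (Function.update (Function.update y i (c • u)) j (d • w)) =
      d • c • f (Function.update (Function.update y j w) i u) := by
    intro c d
    rw [f.map_update_smul, Function.update_comm hij, f.map_update_smul]
  rw [key, key, smul_comm]

/-- **Two columns through one line make `⊗_k ι_k(x_k)` symmetric in the slots `i`, `j`.** If
`ι i = eᵢ ∘ κ` and `ι j = e_j ∘ κ` with `κ : V →ₗ[K] L₀`, `Module.rank K L₀ ≤ 1` and `i ≠ j`, then
`⊗_k ι_k(x_{(i j) k}) = ⊗_k ι_k(x_k)` for every `x : Fin r → V`: writing `κ (x i) = a • v₀`,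
`κ (x j) = b • v₀`, the two families differ from `(ι_k(x_k))_k` only in the slots `i`, `j`, where
they carry `b • eᵢ v₀, a • e_j v₀`, resp. `a • eᵢ v₀, b • e_j v₀`. [folklore] -/
private theorem tprod_ι_comp_swap {K : Type*} [Field K] {r : ℕ} {V L₀ : Type*} [AddCommGroup V]
    [Module K V] [AddCommGroup L₀] [Module K L₀] {L : Fin r → Type*} [∀ k, AddCommGroup (L k)]
    [∀ k, Module K (L k)] (ι : ∀ k : Fin r, V →ₗ[K] L k) (κ : V →ₗ[K] L₀) {i j : Fin r}
    (ei : L₀ →ₗ[K] L i) (ej : L₀ →ₗ[K] L j) (hij : i ≠ j) (hL : Module.rank K L₀ ≤ 1)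
    (hi : ι i = ei.comp κ) (hj : ι j = ej.comp κ) (x : Fin r → V) :
    (⨂ₜ[K] k, ι k (x (Equiv.swap i j k))) = ⨂ₜ[K] k, ι k (x k) := by
  obtain ⟨v₀, hv₀⟩ := rank_le_one_iff.mp hL
  obtain ⟨a, ha⟩ := hv₀ (κ (x i))
  obtain ⟨b, hb⟩ := hv₀ (κ (x j))
  have h1 : (fun k => ι k (x k)) =
      Function.update (Function.update (fun k => ι k (x k)) i (a • ei v₀)) j (b • ej v₀) := by
    funext k
    rcases eq_or_ne k j with rfl | hkj
    · rw [Function.update_self, hj, LinearMap.comp_apply, ← hb, map_smul]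
    · rw [Function.update_of_ne hkj]
      rcases eq_or_ne k i with rfl | hki
      · rw [Function.update_self, hi, LinearMap.comp_apply, ← ha, map_smul]
      · rw [Function.update_of_ne hki]
  have h2 : (fun k => ι k (x (Equiv.swap i j k))) =
      Function.update (Function.update (fun k => ι k (x k)) i (b • ei v₀)) j (a • ej v₀) := by
    funext k
    rcases eq_or_ne k j with rfl | hkj
    · rw [Function.update_self, Equiv.swap_apply_right, hj, LinearMap.comp_apply, ← ha, map_smul]
    · rw [Function.update_of_ne hkj]
      rcases eq_or_ne k i with rfl | hki
      · rw [Function.update_self, Equiv.swap_apply_left, hi, LinearMap.comp_apply, ← hb, map_smul]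
      · rw [Function.update_of_ne hki, Equiv.swap_apply_of_ne_of_ne hki hkj]
  calc (⨂ₜ[K] k, ι k (x (Equiv.swap i j k)))
      = tprod K (Function.update (Function.update (fun k => ι k (x k)) i (b • ei v₀)) j
          (a • ej v₀)) := congrArg (tprod K) h2
    _ = tprod K (Function.update (Function.update (fun k => ι k (x k)) i (a • ei v₀)) j
          (b • ej v₀)) := map_update_update_smul_comm (tprod K) _ hij b a (ei v₀) (ej v₀)
    _ = ⨂ₜ[K] k, ι k (x k) := (congrArg (tprod K) h1).symm

/-- Stub **S4** of line `Sketch` for the crux `PlecticRankUB` (design lemma; Fornea's receptacle,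
two columns through one line): if two of the localisation maps `ι i`, `ι j` (`i ≠ j`) factor
through a common space `L₀` of rank `≤ 1` (`ι i = eᵢ ∘ κ`, `ι j = e_j ∘ κ`), the localised
determinant `locDeterminant ι = Σ_σ sgn σ · ⊗_k ι_k(P_{σ k})` vanishes identically: the
multilinear map `⊗_k ι_k(x_k)` is symmetric in the slots `i`, `j` (`tprod_ι_comp_swap`), so the
Leibniz terms cancel in pairs `σ ↔ σ ∘ (i j)` (`alternatization_eq_zero_of_comp_swap`).
Generalises `Literature.Barriers.BirchSwinnertonDyer.plecticDeterminant_restrict_eq_zero` (all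
columns through the line). [cite: ForneaGehrmann2023, Rem. 1.1] -/
theorem stub_receptacleCollapse :
    ∀ (K : Type) [Field K] (r : ℕ) (V L₀ : Type) [AddCommGroup V] [Module K V] [AddCommGroup L₀]
      [Module K L₀] (L : Fin r → Type) [∀ j, AddCommGroup (L j)] [∀ j, Module K (L j)]
      (ι : ∀ j : Fin r, V →ₗ[K] L j) (κ : V →ₗ[K] L₀) (i j : Fin r) (ei : L₀ →ₗ[K] L i)
      (ej : L₀ →ₗ[K] L j), i ≠ j → Module.rank K L₀ ≤ 1 → ι i = ei.comp κ → ι j = ej.comp κ →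
      locDeterminant ι = 0 := by
  intro K _ r V L₀ _ _ _ _ L _ _ ι κ i j ei ej hij hL hi hj
  unfold locDeterminant
  exact alternatization_eq_zero_of_comp_swap _ hij fun x => by
    simpa only [MultilinearMap.compLinearMap_apply, Function.comp_apply] using
      tprod_ι_comp_swap ι κ ei ej hij hL hi hj x

end Summit.BirchSwinnertonDyer.BirchSwinnertonDyer.Theorems

end
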